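import Summits.Ventures.CertifiedManyBodySolver.Observables.RungLeavesStiffnessK3
import Summits.Ventures.CertifiedManyBodySolver.Observables.StiffnessTLOddMomentOrbitRowTT
import HarnessLib

/-!
# Ventures/CertifiedManyBodySolver — Observables/RungLeavesStiffnessTTPrime.lean

HONEST FRAMING: one-sided certified CEILINGS on the uniform flux stiffness (helicity modulus / superfluid
weight); not a superconductivity verdict; no stiffness floor follows from equal-time data and an energy window
(hubbard-obs-p2 STIFFNESS-SDP.md §4).

Cell `hubbard-obs` (D-0042), seat p2 (stiffness), `prover-hubbard-obs-p2-g6-0`. The stiffness analogue of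
`Observables/RungLeavesTTPrime.lean` (the `t′`-generic pair-window / ODLRO leaves): **the stiffness-ceiling leaf
shape at `(U, n, t′) = (8, 7/8, t′)` for an arbitrary next-nearest-neighbour hopping `t′`** (the A0 anchor
`t′ = −1/4` and any later `t′` row), so that a `t′ ≠ 0` kinetic / odd-moment stiffness claim node has a typed
consumer of the same shape as the `t′ = 0` leaf `M3ObsStiffnessCeilingAt_tp0` (Observables/RungLeaves.lean):

* `M3ObsStiffnessCeilingAt tp c` — every uniform flux stiffness `ρ_s > 0` (scale `θ₀ > 0`, all even `L ≥ L₀`) of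
  the zero-flux `(N_L, 0)` sectors of `hubbardTorusTT' L 1 tp 8` at density `7/8` — i.e. every `ρ_s` with
  `ρ_s θ² ≤ fluxEnergyTT' L tp 8 (1/8) θ − fluxEnergyTT' L tp 8 (1/8) 0` on `|θ| ≤ θ₀` — satisfies `ρ_s ≤ c`
  (tree units; Hazra–Verma–Randeria `D_s = ρ_s/2`, Scalapino–White–Zhang `D/(πe²) = 2ρ_s`);
* `M3ObsStiffnessCeilingAt_zero_iff` — at `tp = 0` it IS `M3ObsStiffnessCeilingAt_tp0 c`
  (`fluxEnergyTT'_tPrime_zero`); `_mono` (monotone transport);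
* `M3ObsStiffnessCeilingAt_of_oddMomentTT_orbitLowerRow[_univ]` — discharger from a certified registry-shaped
  orbit row `M3CorrOrbitLowerRow tp u r S (box 2 7) (−oddMomentObsTT tp 8 λ)` (the `up` edge of the odd-moment
  / Krylov-3 objective `F_λ`, hubbard-obs-p2 R-K3-TL; at `λ = 0` the kinetic f-sum row) plus the energy cap
  `e₀(8, 7/8, tp) ≤ u`, via `fluxStiffness_le_of_oddMomentTT_orbitLowerRow_neg`
  (Observables/StiffnessTLOddMomentOrbitRowTT.lean, p411872); the A0 instance
  `M3ObsStiffnessCeilingAt_tpm1o4_of_oddMoment_orbitLowerRow_univ` (cap node #445 type).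

No new NAMED leaf (the named leaf stays `M3ObsStiffnessCeiling_tp0`), no new fact, zero computation, no `sorry`.
Every proof offered is CONDITIONAL ON THE CLAIM NODES when fed from them (edge node + cap BY NAME; obs-ref
O-D(d5)).

References: [Kohn1964]; D. J. Scalapino, S. R. White, S.-C. Zhang, PRB 47 (1993) 7995, §II
[ScalapinoWhiteZhang1993]; T. Hazra, N. Verma, M. Randeria, PRX 9 (2019) 031049, eqs. (2)–(4)
[HazraVermaRanderia2019].
-/

noncomputable section

namespace Summit.Ventures.CertifiedManyBodySolver.Observables

open Literature.MathematicalPhysics.QuantumLattice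
open Literature.MathematicalPhysics.QuantumLattice.ThermodynamicLimit
open Literature.Probability.LatticeModels
open Filter Topology

/-! ## The stiffness-ceiling leaf at hopping `t′` -/

/-- **M3′-obs stiffness ceiling `c` at `(8, 7/8, t′)`**: every uniform flux stiffness `ρ_s > 0` (scale `θ₀ > 0`,
all even `L ≥ L₀`) of the zero-flux `(N_L, 0)` sectors of `hubbardTorusTT' L 1 tp 8` at density `7/8` satisfies
`ρ_s ≤ c` (tree units; Hazra–Verma–Randeria `D_s = ρ_s/2`, Scalapino–White–Zhang `D/(πe²) = 2ρ_s`). At `tp = 0`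
this is `M3ObsStiffnessCeilingAt_tp0 c` (`M3ObsStiffnessCeilingAt_zero_iff`). [cite: ScalapinoWhiteZhang1993, §II] -/
def M3ObsStiffnessCeilingAt (tp : ℝ) (c : ℚ) : Prop :=
  ∀ (ρs θ₀ : ℝ), 0 < ρs → 0 < θ₀ → ∀ L₀ : ℕ,
    (∀ (L : ℕ) [NeZero L], L₀ ≤ L → Even L →
      ∀ θ : ℝ, |θ| ≤ θ₀ →
        ρs * θ ^ 2 ≤ fluxEnergyTT' L tp 8 (1 / 8) θ - fluxEnergyTT' L tp 8 (1 / 8) 0) →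
    ρs ≤ ((c : ℚ) : ℝ)

/-- At `t′ = 0` the generic stiffness leaf IS `M3ObsStiffnessCeilingAt_tp0 c` (`fluxEnergyTT' L 0 = fluxEnergy L`).
[cite: ScalapinoWhiteZhang1993, §II] -/
theorem M3ObsStiffnessCeilingAt_zero_iff (c : ℚ) :
    M3ObsStiffnessCeilingAt 0 c ↔ M3ObsStiffnessCeilingAt_tp0 c := by
  simp only [M3ObsStiffnessCeilingAt, M3ObsStiffnessCeilingAt_tp0, fluxEnergyTT'_tPrime_zero]

/-- … hence the `t′ = 0` leaf from the generic one at `t′ = 0`. -/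
theorem M3ObsStiffnessCeilingAt_tp0_of_ceilingAt_zero {c : ℚ} (h : M3ObsStiffnessCeilingAt 0 c) :
    M3ObsStiffnessCeilingAt_tp0 c :=
  (M3ObsStiffnessCeilingAt_zero_iff c).1 h

/-- … and the NAMED `t′ = 0` leaf `M3ObsStiffnessCeiling_tp0` from the generic one at `t′ = 0` whenever
`c ≤ 906213886029816052260099/2⁸¹` (the chord literal of record). -/
theorem M3ObsStiffnessCeiling_tp0_of_ceilingAt_zero {c : ℚ} (h : M3ObsStiffnessCeilingAt 0 c)
    (hc : c ≤ 906213886029816052260099 / 2 ^ 81) : M3ObsStiffnessCeiling_tp0 :=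
  M3ObsStiffnessCeilingAt_tp0_mono (M3ObsStiffnessCeilingAt_tp0_of_ceilingAt_zero h) hc

/-- Monotone transport: a ceiling `c` is a ceiling `c'` for every `c ≤ c'`. -/
theorem M3ObsStiffnessCeilingAt_mono {tp : ℝ} {c c' : ℚ} (h : M3ObsStiffnessCeilingAt tp c) (hcc : c ≤ c') :
    M3ObsStiffnessCeilingAt tp c' :=
  fun ρs θ₀ hρs hθ₀ L₀ hst => (h ρs θ₀ hρs hθ₀ L₀ hst).trans (by exact_mod_cast hcc)

/-! ## Dischargers from a certified odd-moment (or kinetic) orbit row at hopping `t′` -/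

/-- **Leaf discharger for a certified `stiffK3` / kinetic edge at hopping `t′`.** If the registry-shaped orbit row
`M3CorrOrbitLowerRow tp u r S (box 2 7) (−oddMomentObsTT tp 8 λ)` holds (`S ⊆ D₄` nonempty) and the energy cap
`e₀(8, 7/8, tp) ≤ u` is certified, then `M3ObsStiffnessCeilingAt tp c` holds for every `c ≥ −r` (tree units) —
one application of `fluxStiffness_le_of_oddMomentTT_orbitLowerRow_neg` (p411872). [cite: ScalapinoWhiteZhang1993, §II] -/
theorem M3ObsStiffnessCeilingAt_of_oddMomentTT_orbitLowerRow (tp lam : ℝ) {u r : ℚ}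
    (S : Finset (DihedralGroup 4)) (hS : S.Nonempty)
    (hrow : M3CorrOrbitLowerRow tp u r S (box 2 7) (-oddMomentObsTT tp 8 lam))
    (hu : energyDensityTT' 1 tp 8 (7 / 8) ≤ ((u : ℚ) : ℝ)) (c : ℚ) (hc : -r ≤ c) :
    M3ObsStiffnessCeilingAt tp c := by
  intro ρs θ₀ _ hθ₀ L₀ hst
  have hrow' : SquareTTPrimeCorrOrbitLowerRow tp 8 (1 - 1 / 8) u r S (box 2 7)
      (-oddMomentObsTT tp 8 lam) := by
    rw [show (1 - 1 / 8 : ℝ) = 7 / 8 by norm_num]; exact hrow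
  have hu' : energyDensityTT' 1 tp 8 (1 - 1 / 8) ≤ ((u : ℚ) : ℝ) := by
    rw [show (1 - 1 / 8 : ℝ) = 7 / 8 by norm_num]; exact hu
  exact (fluxStiffness_le_of_oddMomentTT_orbitLowerRow_neg tp lam S hS (by norm_num) (by norm_num) hθ₀ hst
    hrow' hu').trans (by exact_mod_cast hc)

/-- The same with the full point group `S = D₄` (the host's reduction group) — the form the node files of the cell
state (`… Finset.univ Λ X`). [cite: ScalapinoWhiteZhang1993, §II] -/
theorem M3ObsStiffnessCeilingAt_of_oddMomentTT_orbitLowerRow_univ (tp lam : ℝ) {u r : ℚ}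
    (hrow : M3CorrOrbitLowerRow tp u r Finset.univ (box 2 7) (-oddMomentObsTT tp 8 lam))
    (hu : energyDensityTT' 1 tp 8 (7 / 8) ≤ ((u : ℚ) : ℝ)) (c : ℚ) (hc : -r ≤ c) :
    M3ObsStiffnessCeilingAt tp c :=
  M3ObsStiffnessCeilingAt_of_oddMomentTT_orbitLowerRow tp lam Finset.univ Finset.univ_nonempty hrow hu c hc

/-- **A0 instance (`t′ = −1/4`)**: a certified orbit row `M3CorrOrbitLowerRow (−1/4) u r univ (box 2 7)
(−oddMomentObsTT (−1/4) 8 λ)` plus the A0 energy cap `e₀(8, 7/8, −1/4) ≤ u` (node #445 type) give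
`M3ObsStiffnessCeilingAt (−1/4) c` for every `c ≥ −r` — the same sentence as
`m3_tpm1o4_fluxStiffness_le_of_oddMoment_orbitLowerRow_neg` in leaf form. HONEST FRAMING: one-sided ceiling; not a
superconductivity verdict. [cite: ScalapinoWhiteZhang1993, §II] -/
theorem M3ObsStiffnessCeilingAt_tpm1o4_of_oddMoment_orbitLowerRow_univ (lam : ℝ) {u r : ℚ}
    (hrow : M3CorrOrbitLowerRow (-1 / 4) u r Finset.univ (box 2 7) (-oddMomentObsTT (-1 / 4) 8 lam))
    (hu : energyDensityTT' 1 (-1 / 4) 8 (7 / 8) ≤ ((u : ℚ) : ℝ)) (c : ℚ) (hc : -r ≤ c) :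
    M3ObsStiffnessCeilingAt (-1 / 4) c :=
  M3ObsStiffnessCeilingAt_of_oddMomentTT_orbitLowerRow_univ (-1 / 4) lam hrow hu c hc

end Summit.Ventures.CertifiedManyBodySolver.Observables

end
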